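import Literature.Computability.AlgebraicComplexity.DDS21WedgeWedgeClass
import Literature.Computability.AlgebraicComplexity.DDS21GradedFractions
import Mathlib.RingTheory.MvPolynomial.Homogeneous
import Mathlib.RingTheory.Derivation.Basic
import Mathlib.Algebra.Polynomial.Degree.SmallDegree
import HarnessLib

/-!
# DDS21 §2.3 for `Σ∧Σ∧`: multiplicative closure, substitutions, derivatives, homogeneous components

Theorem-only companion (cell `val-lit`, brick **B6-1** of the sizing memo
`HOME/np/MEMO-p1g10-DDS21-B6-Thm51-sizing.md`; the named fact `DDS2021_thm_5_1` stays OPEN by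
name) of `DDS21WedgeWedgeClass.lean` (B6-0: `wedgeForm a p = a + ∑_m p_m(x_m)`, the class
`swswClass K n t e δ` = `Σ∧Σ∧(t, e, δ)` and its additive/folklore API), the `Σ∧Σ∧` twin of the
`Σ∧Σ` toolkit `DDS21DepthThreeDiagonalToolkit.lean` (B2) and of §6 of `DDS21GradedFractions.lean`
(B4a). Source: P. Dutta, P. Dwivedi, N. Saxena, *Demystifying the border of depth-3 algebraic
circuits*, FOCS 2021, FULL VERSION (`paper:galaxy-pdf-7641649743695546420`, printed line numbers
`Lnnn`): §2.3, where each `Σ∧Σ` lemma carries the remark that it "hold[s] good for the more general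
`Σ∧Σ∧` circuits" (Lemma 2.12 Remark p0020 L556–557; Lemma 2.13 Remark p0021 L568; Lemma 2.15
Remark p0022 L584), and §5, Claim 5.2 with its proof (p0044 L1164–1178: "(3.3) can be written for
`Σ∧` circuits, giving a `Σ∧Σ∧` circuit … `dlog(h) = −∂_z(z·B)/A · ∑_j (zB/A)^j` … Once we use the
fact that `Σ∧Σ∧` is closed under multiplication (Lemma 2.12), it readily follows that
`dlog(ΠΣ∧) ∈ Σ∧Σ∧`. Moreover, the derivative of `Σ∧Σ∧` is again a `Σ∧Σ∧` circuit, due to easy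
interpolation (Lemma 2.15)") [DuttaDwivediSaxena2022]. Budgets are the triple `(t, e, δ)` of B6-0
(SIZE CONVENTION there).

## What is printed and what is proved (every statement PROVED; no definitions, no named facts)

* §1 algebra of `Σ∧` forms: the Waring pencil `wedgeForm_add_C_mul` (`g + u·g'` is a `Σ∧` form),
  diagonal affine substitutions `aeval_diagAffine_wedgeForm` (`x_m ↦ β_m x_m + α_m` composes the
  univariates), `pderiv_wedgeForm` (`∂_m g = p_m'(x_m)`, Mathlib's `Derivation.map_aeval`).
* §2 **Lemma 2.11/2.12 for `Σ∧Σ∧`** (p0020 L542–557): `wedgePow_mul_wedgePow_mem_swswClass`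
  (`c g^k · c' g'^{k'} ∈ Σ∧Σ∧(k+k'+1, k+k', δ)` by B2's interpolation Waring identity
  `exists_waringWeights_two`, nodes `0, …, k+k'`), ★`mul_mem_swswClass`
  (`Σ∧Σ∧(t₁,e₁,δ) · Σ∧Σ∧(t₂,e₂,δ) ⊆ Σ∧Σ∧(t₁t₂(e₁+e₂+1), e₁+e₂, δ)`), `one/prod/pow_mem_swswClass`.
* §3 substitutions (the source's `Φ : x ↦ z·x + α` at a fixed scalar, p0044 L1159–1161):
  `aeval_diagAffine/shift/dilate_mem_swswClass` — same budgets.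
* §4 **Lemma 2.15 for `Σ∧Σ∧`** (p0021 L578 – p0022 L584): `pderiv_mem_swswClass`
  (`∂_m f ∈ Σ∧Σ∧(t(e+1), e, δ)`: `∂_m(c g^k) = (ck)·p_m'(x_m)·g^{k−1}` is a product of the lone
  univariate `(0 + p_m')^1` and a power, handled by §2; the print's bound is `O(s d²)`).
* §5 **Lemma 2.14 for `Σ∧Σ∧`, graded form** (p0021 L569–576 + Remarks):
  ★`homogeneousComponent_mem_swswClass` (`f_u ∈ Σ∧Σ∧(t(eδ+1), e, δ)`) by interpolation on the
  DILATION — `P(v·x) = ∑_u v^u P_u(x)` (`aeval_dilate_eq_sum_homogeneousComponent`), the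
  inverse-Vandermonde row of `DepthThreeChasm.exists_dual_weights` and B2's
  `factorial_mul_coeff_eq_sum_eval`, each `P(v·x)` again a power of a `Σ∧` form (§3) — and the jet
  version `sum_homogeneousComponent_mem_swswClass`. (For `Σ∧Σ` the pieces are single powers of the
  linear part, B4a `homogeneousComponent_mem_swsClass`; for `Σ∧Σ∧` a power of a sum of univariates is
  not graded by a single power, whence the interpolation and the factor `eδ + 1`.)
* §6 **Claim 5.2 / eq. (3.3) for `Σ∧` forms, graded and exact** (p0044 L1164–1175), in B4a's
  `gcomp`/`invJet` currency: `coeff_zero_wedgeForm`, `C_coeff_zero_sub_wedgeForm`,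
  `invJet_wedgeForm_mem_swswClass` (`∑_{i≤c} g(0)^{−(i+1)}(g(0) − g)^i ∈ Σ∧Σ∧(c+1, c, δ)` — no Waring
  needed), ★`gcomp_wedgeForm_mem_swswClass` (graded pieces of `P/g`, `P ∈ Σ∧Σ∧`, `g(0) ≠ 0`),
  `gcomp_one_wedgeForm_mem_swswClass` (pieces of `1/g`), `euler_wedgeForm` (`Eg = ∑_m x_m p_m'(x_m)`
  is a `Σ∧` form), `euler_wedgeForm_mem_swswClass`, ★`gcomp_euler_wedgeForm_mem_swswClass` (pieces of
  `dlog g = Eg/g` lie in `Σ∧Σ∧((c+1)(c+2)((c+1)δ+1), c+1, δ)`) — the class-level input of the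
  `Σ∧Σ∧` certificates of the DiDIL step (memo brick B6-3; B4b `DDS21DiDILStep` `PiRatio.cert_dlog` is
  the `Σ∧Σ` instance via B4a `gcomp_linear_affine`).

Deviations from print, disclosed: interpolation nodes `0, 1, …` instead of roots of unity, hence
`[CharZero K]` on §2, §4, §5, §6 (the source: "`ℂ`, or a small extension"); Lemma 2.15 via the
Waring pencil rather than via coefficient extraction; the Euler derivation `E = ∑ x_m ∂_m` (B4a
`euler`) in place of `∂_z` after the degree-tagging map `Φ` (as in B4a/B4b, memo R0); exact graded
pieces (`gcomp`, no truncation "`j < d₁`") as in B4b; budgets explicit triples instead of `O(·)`.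
Not here: the read-once / ARO conversion of `Σ∧Σ∧` (Lemma 2.17, Lemma 2.23 — brick B6-2,
`DDS21WedgeWedgeReadOnce.lean`, val-lit p1) and the re-instantiation of B4b's certificates on
`swswClass` (brick B6-3).

Honest framing: closure bookkeeping for a restricted depth-4 circuit class, banked toward the
x-row `DDS2021_thm_5_1`; it discharges nothing by itself; `VP ≠ VNP` is NOT proved and nothing
here bears on it.

## References

* [DuttaDwivediSaxena2022] P. Dutta, P. Dwivedi, N. Saxena, *Demystifying the border of depth-3
  algebraic circuits*, Proc. 62nd FOCS (2021), IEEE 2022, 92–103; full version §2.3, Lemmas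
  2.11–2.15 with the `Σ∧Σ∧` remarks (p0020 L542 – p0022 L584), §3 eq. (3.3) (p0032 L854–862),
  §5 Thm. 5.1 proof sketch and Claim 5.2 (p0043 L1151 – p0045 L1).
* [GuptaKamathKayalSaptharishi2016] A. Gupta, P. Kamath, N. Kayal, R. Saptharishi, *Arithmetic
  circuits: a chasm at depth 3*, SIAM J. Comput. 45 (2016) — the inverse-Vandermonde weights
  `DepthThreeChasm.exists_dual_weights` used in §2 and §5 (tree, cited not restated).
-/

noncomputable section

open MvPolynomial
open scoped BigOperators

namespace Literature.Computability.AlgebraicComplexity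

namespace DDS2021

universe u

variable {K : Type*} [Field K] {n : ℕ}

/-! ## §1 Algebra of `Σ∧` forms -/

section FormAlgebra

/-- `Σ∧` forms are closed under the pencil operation of the Waring identity:
`g + u · g' = (a + u a') + ∑_m (p_m + u p'_m)(x_m)`.
[cite: DuttaDwivediSaxena2022, Lemma 2.12 Remark (full version p0020 L552–557)] -/
theorem wedgeForm_add_C_mul (a a' u : K) (p p' : Fin n → Polynomial K) :
    wedgeForm a p + C u * wedgeForm a' p' =
      wedgeForm (a + u * a') (fun m => p m + Polynomial.C u * p' m) := by
  simp only [wedgeForm_eq, map_add, map_mul, Polynomial.aeval_C, algebraMap_eq, mul_add,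
    Finset.mul_sum, Finset.sum_add_distrib]
  ring

/-- Degree bookkeeping for the pencil `p + u · p'`. [folklore] -/
private theorem natDegree_add_C_mul_le {δ : ℕ} (u : K) {q q' : Polynomial K}
    (hq : q.natDegree ≤ δ) (hq' : q'.natDegree ≤ δ) :
    (q + Polynomial.C u * q').natDegree ≤ δ :=
  (Polynomial.natDegree_add_le _ _).trans
    (max_le hq ((Polynomial.natDegree_C_mul_le _ _).trans hq'))

/-- **Diagonal affine substitutions** `x_m ↦ β_m x_m + α_m` (the source's `Φ : x ↦ z·x + α` at a
fixed scalar `z`, shifts `x ↦ x + α`, and the dilations `x ↦ v·x` used for homogeneous components)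
map a `Σ∧` form to the `Σ∧` form with the composed univariates `p_m(β_m X + α_m)`.
[cite: DuttaDwivediSaxena2022, §5 proof of Thm. 5.1, "we use the same Φ" (full version p0044 L1159–1161)] -/
theorem aeval_diagAffine_wedgeForm (β α : Fin n → K) (a : K) (p : Fin n → Polynomial K) :
    aeval (fun m : Fin n => (C (β m) * X m + C (α m) : MvPolynomial (Fin n) K)) (wedgeForm a p) =
      wedgeForm a (fun m => (p m).comp (Polynomial.C (β m) * Polynomial.X + Polynomial.C (α m))) := by
  rw [wedgeForm_eq, wedgeForm_eq, map_add, aeval_C, algebraMap_eq, map_sum]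
  congr 1
  refine Finset.sum_congr rfl fun m _ => ?_
  rw [← Polynomial.aeval_algHom_apply, aeval_X, Polynomial.aeval_comp]
  congr 1
  simp only [map_add, map_mul, Polynomial.aeval_C, Polynomial.aeval_X, algebraMap_eq]

/-- Degree bookkeeping: composing with a linear univariate does not raise the degree. [folklore] -/
private theorem natDegree_comp_linear_le {δ : ℕ} (b c : K) {q : Polynomial K}
    (hq : q.natDegree ≤ δ) :
    (q.comp (Polynomial.C b * Polynomial.X + Polynomial.C c)).natDegree ≤ δ :=
  Polynomial.natDegree_comp_le.trans
    ((Nat.mul_le_mul hq Polynomial.natDegree_linear_le).trans (by rw [mul_one]))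

/-- **The partial derivative of a `Σ∧` form is a univariate**: `∂_{x_m}(a + ∑_j p_j(x_j)) =
p_m'(x_m)`. [cite: DuttaDwivediSaxena2022, Lemma 2.15 Remark (full version p0021 L578 – p0022 L584)] -/
theorem pderiv_wedgeForm (m : Fin n) (a : K) (p : Fin n → Polynomial K) :
    pderiv m (wedgeForm a p) =
      Polynomial.aeval (X m : MvPolynomial (Fin n) K) (Polynomial.derivative (p m)) := by
  classical
  rw [wedgeForm_eq, map_add, pderiv_C, zero_add, map_sum, Finset.sum_eq_single m]
  · rw [(pderiv m).map_aeval, pderiv_X_self, smul_eq_mul, mul_one]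
  · intro j _ hj
    rw [(pderiv m).map_aeval, pderiv_X_of_ne hj, smul_zero]
  · intro hm
    exact absurd (Finset.mem_univ m) hm

end FormAlgebra

/-! ## §2 Lemma 2.11/2.12 for `Σ∧Σ∧`: products -/

section Mul

/-- **A product of two (scaled) powers of `Σ∧` forms is in `Σ∧Σ∧(k+k'+1, k+k', δ)`**: by B2's
interpolation form of the Waring identity (`exists_waringWeights_two`),
`g^k · g'^{k'} = ∑_{u=0}^{k+k'} w_u (g + u g')^{k+k'}` and each `g + u g'` is again a `Σ∧` form with
univariates of the same degrees ("Each summand of `∏_i f_i` after expanding can be expressed as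
`Σ∧Σ` using Lemma 2.11 … hold good for the more general `Σ∧Σ∧` circuits").
[cite: DuttaDwivediSaxena2022, Lemma 2.11 and Lemma 2.12 with Remark (full version p0020 L542–557)] -/
theorem wedgePow_mul_wedgePow_mem_swswClass [CharZero K] {δ : ℕ} (c c' a a' : K)
    {p p' : Fin n → Polynomial K} (hp : ∀ m, (p m).natDegree ≤ δ)
    (hp' : ∀ m, (p' m).natDegree ≤ δ) (k k' : ℕ) :
    C c * wedgeForm a p ^ k * (C c' * wedgeForm a' p' ^ k') ∈
      swswClass K n (k + k' + 1) (k + k') δ := by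
  obtain ⟨w, hw⟩ := exists_waringWeights_two (K := K) k k'
  have hprod := hw (MvPolynomial (Fin n) K) (wedgeForm a p) (wedgeForm a' p')
  refine mem_swswClass_of_fintype (ι := Fin (k + k' + 1)) (by simp)
    (fun v => c * c' * w v) (fun v => a + ((v : ℕ) : K) * a')
    (fun v m => p m + Polynomial.C (((v : ℕ) : K)) * p' m) (fun _ => k + k')
    (fun _ => le_rfl) (fun v m => natDegree_add_C_mul_le _ (hp m) (hp' m)) ?_
  calc C c * wedgeForm a p ^ k * (C c' * wedgeForm a' p' ^ k')
      = C (c * c') * (wedgeForm a p ^ k * wedgeForm a' p' ^ k') := by rw [C_mul]; ring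
    _ = C (c * c') * ∑ v : Fin (k + k' + 1), algebraMap K (MvPolynomial (Fin n) K) (w v) *
          (wedgeForm a p + ((v : ℕ) : MvPolynomial (Fin n) K) * wedgeForm a' p') ^ (k + k') := by
        rw [hprod]
    _ = ∑ v : Fin (k + k' + 1), C (c * c' * w v) *
          wedgeForm (a + ((v : ℕ) : K) * a') (fun m => p m + Polynomial.C (((v : ℕ) : K)) * p' m) ^
            (k + k') := by
        rw [Finset.mul_sum]
        refine Finset.sum_congr rfl fun v _ => ?_
        rw [MvPolynomial.algebraMap_eq, ← mul_assoc, ← C_mul, ← wedgeForm_add_C_mul, map_natCast]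

/-- **DDS21 Lemma 2.12 for `Σ∧Σ∧` (closed under multiplication), two factors, with budgets**:
`f ∈ Σ∧Σ∧(t₁, e₁, δ)`, `g ∈ Σ∧Σ∧(t₂, e₂, δ)` ⇒ `f · g ∈ Σ∧Σ∧(t₁ t₂ (e₁ + e₂ + 1), e₁ + e₂, δ)`
("The above lemma, and its proof, hold good for the more general `Σ∧Σ∧` circuits", L556–557).
Characteristic zero (interpolation nodes `0, …, e₁ + e₂`).
[cite: DuttaDwivediSaxena2022, Lemma 2.12 with Remark (full version p0020 L549–557)] -/
theorem mul_mem_swswClass [CharZero K] {t₁ t₂ e₁ e₂ δ : ℕ} {f g : MvPolynomial (Fin n) K}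
    (hf : f ∈ swswClass K n t₁ e₁ δ) (hg : g ∈ swswClass K n t₂ e₂ δ) :
    f * g ∈ swswClass K n (t₁ * t₂ * (e₁ + e₂ + 1)) (e₁ + e₂) δ := by
  obtain ⟨c, a, p, ex, hex, hp, rfl⟩ := hf
  obtain ⟨c', a', p', ex', hex', hp', rfl⟩ := hg
  rw [Finset.sum_mul_sum, ← Finset.sum_product']
  have hcard : (Finset.univ ×ˢ Finset.univ : Finset (Fin t₁ × Fin t₂)).card * (e₁ + e₂ + 1) =
      t₁ * t₂ * (e₁ + e₂ + 1) := by
    rw [Finset.card_product, Finset.card_univ, Finset.card_univ, Fintype.card_fin, Fintype.card_fin]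
  rw [← hcard]
  refine sum_mem_swswClass _ _ fun q _ => ?_
  exact swswClass_mono (by have := hex q.1; have := hex' q.2; omega)
    (Nat.add_le_add (hex q.1) (hex' q.2)) le_rfl
    (wedgePow_mul_wedgePow_mem_swswClass (c q.1) (c' q.2) (a q.1) (a' q.2) (hp q.1) (hp' q.2)
      (ex q.1) (ex' q.2))

/-- `1 ∈ Σ∧Σ∧(1, 0, 0)`. [cite: DuttaDwivediSaxena2022, Lemma 2.12 Remark (full version p0020 L556–557)] -/
theorem one_mem_swswClass : (1 : MvPolynomial (Fin n) K) ∈ swswClass K n 1 0 0 := by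
  have h := C_mem_swswClass (n := n) (e := 0) (δ := 0) le_rfl (1 : K)
  rwa [C_1] at h

/-- **Lemma 2.12 for `Σ∧Σ∧`, `k` factors with a uniform budget**: if every
`f_i ∈ Σ∧Σ∧(t, e, δ)` then `∏_{i ∈ s} f_i ∈ Σ∧Σ∧(t^{#s} (#s·e + 1)^{#s}, #s·e, δ)`.
[cite: DuttaDwivediSaxena2022, Lemma 2.12 with Remark (full version p0020 L549–557)] -/
theorem prod_mem_swswClass [CharZero K] {ι : Type*} {t e δ : ℕ} (s : Finset ι)
    (f : ι → MvPolynomial (Fin n) K) (hf : ∀ i ∈ s, f i ∈ swswClass K n t e δ) :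
    ∏ i ∈ s, f i ∈ swswClass K n (t ^ s.card * (s.card * e + 1) ^ s.card) (s.card * e) δ := by
  classical
  induction s using Finset.induction_on with
  | empty =>
    simpa using swswClass_mono (K := K) (n := n) le_rfl le_rfl (Nat.zero_le δ) one_mem_swswClass
  | @insert b s hb ih =>
    rw [Finset.prod_insert hb, Finset.card_insert_of_notMem hb]
    have hfb := hf b (Finset.mem_insert_self b s)
    have hrest := ih fun i hi => hf i (Finset.mem_insert_of_mem hi)
    have hmul := mul_mem_swswClass hfb hrest
    refine swswClass_mono ?_ (by rw [Nat.succ_mul]; omega) le_rfl hmul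
    have h1 : (s.card * e + 1) ^ s.card ≤ ((s.card + 1) * e + 1) ^ s.card :=
      Nat.pow_le_pow_left (by nlinarith) _
    calc t * (t ^ s.card * (s.card * e + 1) ^ s.card) * (e + s.card * e + 1)
        = t ^ (s.card + 1) * ((s.card * e + 1) ^ s.card * ((s.card + 1) * e + 1)) := by ring
      _ ≤ t ^ (s.card + 1) * (((s.card + 1) * e + 1) ^ s.card * ((s.card + 1) * e + 1)) :=
          Nat.mul_le_mul_left _ (Nat.mul_le_mul_right _ h1)
      _ = t ^ (s.card + 1) * ((s.card + 1) * e + 1) ^ (s.card + 1) := by ring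

/-- **Powers**: `f ∈ Σ∧Σ∧(t, e, δ)` ⇒ `f^k ∈ Σ∧Σ∧(t^k (k e + 1)^k, k e, δ)`.
[cite: DuttaDwivediSaxena2022, Lemma 2.12 with Remark (full version p0020 L549–557)] -/
theorem pow_mem_swswClass [CharZero K] {t e δ : ℕ} (k : ℕ) {f : MvPolynomial (Fin n) K}
    (hf : f ∈ swswClass K n t e δ) :
    f ^ k ∈ swswClass K n (t ^ k * (k * e + 1) ^ k) (k * e) δ := by
  have h := prod_mem_swswClass (Finset.univ : Finset (Fin k)) (fun _ => f) fun _ _ => hf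
  simpa using h

end Mul

/-! ## §3 Substitutions: `Φ` at a fixed scalar, shifts, dilations -/

section Subst

/-- **Diagonal affine substitutions preserve `Σ∧Σ∧(t, e, δ)`** with the same budgets: for
scalars `β_m, α_m`, `f(β_1 x_1 + α_1, …, β_n x_n + α_n) ∈ Σ∧Σ∧(t, e, δ)` whenever
`f ∈ Σ∧Σ∧(t, e, δ)` (the source's `Φ : x_i ↦ z·x_i + α_i` at a fixed value of `z`; "since `α_i` are
random, the bottom `Σ∧` circuits are 'invertible'", p0044 L1160).
[cite: DuttaDwivediSaxena2022, §5 proof of Thm. 5.1 (full version p0044 L1159–1161)] -/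
theorem aeval_diagAffine_mem_swswClass {t e δ : ℕ} (β α : Fin n → K) {f : MvPolynomial (Fin n) K}
    (hf : f ∈ swswClass K n t e δ) :
    aeval (fun m : Fin n => (C (β m) * X m + C (α m) : MvPolynomial (Fin n) K)) f ∈
      swswClass K n t e δ := by
  obtain ⟨c, a, p, ex, hex, hp, rfl⟩ := hf
  rw [map_sum]
  refine mem_swswClass_of_fintype (ι := Fin t) (by simp) c a
    (fun i m => (p i m).comp (Polynomial.C (β m) * Polynomial.X + Polynomial.C (α m))) ex hex
    (fun i m => natDegree_comp_linear_le _ _ (hp i m)) ?_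
  refine Finset.sum_congr rfl fun i _ => ?_
  rw [map_mul, map_pow, aeval_C, algebraMap_eq, aeval_diagAffine_wedgeForm]

/-- **Shifts** `x ↦ x + α` preserve `Σ∧Σ∧(t, e, δ)`.
[cite: DuttaDwivediSaxena2022, §5 proof of Thm. 5.1 (full version p0044 L1159–1161)] -/
theorem aeval_shift_mem_swswClass {t e δ : ℕ} (α : Fin n → K) {f : MvPolynomial (Fin n) K}
    (hf : f ∈ swswClass K n t e δ) :
    aeval (fun m : Fin n => (X m + C (α m) : MvPolynomial (Fin n) K)) f ∈ swswClass K n t e δ := by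
  have h := aeval_diagAffine_mem_swswClass (fun _ => (1 : K)) α hf
  simpa only [C_1, one_mul] using h

/-- **Dilations** `x ↦ ζ·x` preserve `Σ∧Σ∧(t, e, δ)`.
[cite: DuttaDwivediSaxena2022, §5 proof of Thm. 5.1 (full version p0044 L1159–1161)] -/
theorem aeval_dilate_mem_swswClass {t e δ : ℕ} (ζ : K) {f : MvPolynomial (Fin n) K}
    (hf : f ∈ swswClass K n t e δ) :
    aeval (fun m : Fin n => (C ζ * X m : MvPolynomial (Fin n) K)) f ∈ swswClass K n t e δ := by
  have h := aeval_diagAffine_mem_swswClass (fun _ => ζ) (fun _ => (0 : K)) hf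
  simpa only [C_0, add_zero] using h

end Subst

/-! ## §4 Lemma 2.15 for `Σ∧Σ∧`: partial derivatives -/

section Deriv

/-- **DDS21 Lemma 2.15 for `Σ∧Σ∧` (differentiation), with budgets**: `f ∈ Σ∧Σ∧(t, e, δ)` ⇒
`∂_{x_m} f ∈ Σ∧Σ∧(t·(e+1), e, δ)`: `∂_m(c·g^k) = (c k)·p_m'(x_m)·g^{k−1}` is a product of the
univariate `p_m'(x_m) = (0 + p_m'(x_m))^1` and a power, hence (Lemma 2.11, nodes `0, …, k`) a sum
of `k + 1 ≤ e + 1` powers `(g_v)^k` of `Σ∧` forms ("Same property holds for `Σ∧Σ∧` circuits",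
p0022 L584; the print's bound is `O(s d²)`). Characteristic zero.
[cite: DuttaDwivediSaxena2022, Lemma 2.15 with Remark (full version p0021 L578 – p0022 L584)] -/
theorem pderiv_mem_swswClass [CharZero K] {t e δ : ℕ} (m : Fin n) {f : MvPolynomial (Fin n) K}
    (hf : f ∈ swswClass K n t e δ) : pderiv m f ∈ swswClass K n (t * (e + 1)) e δ := by
  classical
  obtain ⟨c, a, p, ex, hex, hp, rfl⟩ := hf
  rw [map_sum]
  have h := sum_univ_mem_swswClass (K := K) (n := n) (t := e + 1) (e := e) (δ := δ)
    (fun i => pderiv m (C (c i) * wedgeForm (a i) (p i) ^ ex i)) fun i => by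
      rw [pderiv_C_mul, (pderiv m).leibniz_pow, pderiv_wedgeForm, smul_eq_mul]
      rcases Nat.eq_zero_or_pos (ex i) with h0 | hpos
      · rw [h0, zero_smul, mul_zero]
        exact zero_mem_swswClass _ _ _
      · -- `c · (k · g^{k-1} · p_m'(x_m)) = (c k) · (0 + p_m')^1 · (1 · g^{k-1})`
        have hderiv : ∀ j, (Pi.single (M := fun _ : Fin n => Polynomial K) m
            (Polynomial.derivative (p i m)) j).natDegree ≤ δ := by
          intro j
          by_cases hj : j = m
          · subst hj
            rw [Pi.single_eq_same]
            exact (Polynomial.natDegree_derivative_le _).trans ((Nat.sub_le _ _).trans (hp i j))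
          · rw [Pi.single_eq_of_ne hj, Polynomial.natDegree_zero]
            exact Nat.zero_le _
        have hw := wedgePow_mul_wedgePow_mem_swswClass (n := n) (c i * (ex i : K)) 1 0 (a i)
          hderiv (hp i) 1 (ex i - 1)
        rw [pow_one, wedgeForm_zero_single, C_1, one_mul,
          show 1 + (ex i - 1) = ex i from by omega] at hw
        refine swswClass_mono (Nat.succ_le_succ (hex i)) (hex i) le_rfl ?_
        convert hw using 1
        rw [nsmul_eq_mul, C_mul, map_natCast]
        ring
  rwa [Fintype.card_fin] at h

end Deriv

/-! ## §5 Lemma 2.14 for `Σ∧Σ∧`: homogeneous components by interpolation on dilations -/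

section Graded

/-- **Dilation of a homogeneous polynomial**: `φ(ζ·x) = ζ^u · φ(x)` for `φ` homogeneous of degree
`u`. [folklore] -/
private theorem aeval_dilate_of_isHomogeneous {u : ℕ} {φ : MvPolynomial (Fin n) K}
    (hφ : φ.IsHomogeneous u) (ζ : K) :
    aeval (fun m : Fin n => (C ζ * X m : MvPolynomial (Fin n) K)) φ = C (ζ ^ u) * φ := by
  classical
  conv_lhs => rw [φ.as_sum]
  conv_rhs => rw [φ.as_sum]
  rw [map_sum, Finset.mul_sum]
  refine Finset.sum_congr rfl fun d hd => ?_
  have hdeg : d.degree = u := by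
    by_contra h
    exact (mem_support_iff.1 hd) (hφ.coeff_eq_zero h)
  have hsum : ∑ i ∈ d.support, d i = u := by rw [← Finsupp.degree_apply, hdeg]
  rw [aeval_monomial, algebraMap_eq, monomial_eq, Finsupp.prod, Finsupp.prod]
  simp_rw [mul_pow]
  rw [Finset.prod_mul_distrib, Finset.prod_pow_eq_pow_sum, hsum, ← map_pow]
  ring

/-- **Dilation spreads a polynomial along its homogeneous components**:
`P(ζ·x) = ∑_{u ≤ N} ζ^u · P_u(x)` for `N ≥ deg P`. [folklore] -/
private theorem aeval_dilate_eq_sum_homogeneousComponent {N : ℕ} (P : MvPolynomial (Fin n) K)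
    (hN : P.totalDegree ≤ N) (ζ : K) :
    aeval (fun m : Fin n => (C ζ * X m : MvPolynomial (Fin n) K)) P =
      ∑ u ∈ Finset.range (N + 1), C (ζ ^ u) * homogeneousComponent u P := by
  have hP : P = ∑ u ∈ Finset.range (N + 1), homogeneousComponent u P := by
    conv_lhs => rw [← sum_homogeneousComponent P]
    refine Finset.sum_subset (Finset.range_subset_range.2 (Nat.succ_le_succ hN)) ?_
    intro u _ hu
    rw [Finset.mem_range, not_lt] at hu
    exact homogeneousComponent_eq_zero _ _ (Nat.lt_of_succ_le hu)
  conv_lhs => rw [hP]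
  rw [map_sum]
  exact Finset.sum_congr rfl fun u _ =>
    aeval_dilate_of_isHomogeneous (homogeneousComponent_isHomogeneous u P) ζ

/-- **Homogeneous components of a `Σ∧Σ∧` circuit (graded Lemma 2.14 for `Σ∧Σ∧`)**:
`f ∈ Σ∧Σ∧(t, e, δ)` ⇒ `f_u ∈ Σ∧Σ∧(t·(e·δ + 1), e, δ)` for every degree `u`. Interpolation on the
dilation: for one term `P = c·g^k` (total degree `≤ N := e·δ`), `P(v·x) = ∑_{u ≤ N} v^u P_u(x)`,
so with the inverse-Vandermonde row `β` of `DepthThreeChasm.exists_dual_weights N u` (nodes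
`0, …, N`) and B2's `factorial_mul_coeff_eq_sum_eval`, `u! · P_u = ∑_{v=0}^{N} β_v · P(v·x)`, and each
`P(v·x) = c · g(v·x)^k` is again a power of a `Σ∧` form with univariates of degree `≤ δ` (print:
"Interpolate using `(d+1)`-many distinct points", for `Σ∧Σ`; "Same property holds for `Σ∧Σ∧`").
Characteristic zero. [cite: DuttaDwivediSaxena2022, Lemma 2.14 and Remarks (full version p0021 L569 – p0022 L584)] -/
theorem homogeneousComponent_mem_swswClass [CharZero K] {t e δ : ℕ} {f : MvPolynomial (Fin n) K}
    (hf : f ∈ swswClass K n t e δ) (u : ℕ) :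
    homogeneousComponent u f ∈ swswClass K n (t * (e * δ + 1)) e δ := by
  classical
  set N : ℕ := e * δ with hN
  by_cases hu : N < u
  · rw [homogeneousComponent_eq_zero _ _ ((totalDegree_le_of_mem_swswClass hf).trans_lt hu)]
    exact zero_mem_swswClass _ _ _
  rw [not_lt] at hu
  obtain ⟨c, a, p, ex, hex, hp, rfl⟩ := hf
  rw [map_sum (homogeneousComponent u)]
  have h := sum_univ_mem_swswClass (K := K) (n := n) (t := N + 1) (e := e) (δ := δ)
    (fun i => homogeneousComponent u (C (c i) * wedgeForm (a i) (p i) ^ ex i)) fun i => by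
      -- one term `P = c · g^k`
      set P : MvPolynomial (Fin n) K := C (c i) * wedgeForm (a i) (p i) ^ ex i with hPdef
      have hPdeg : P.totalDegree ≤ N := by
        refine (totalDegree_mul _ _).trans ?_
        rw [totalDegree_C, zero_add]
        refine (totalDegree_pow _ _).trans ?_
        exact Nat.mul_le_mul (hex i) (totalDegree_wedgeForm_le (a i) (hp i))
      -- the generating polynomial `Q(T) = ∑_{u ≤ N} P_u T^u` over `A = K[x]`
      set Q : Polynomial (MvPolynomial (Fin n) K) :=
        ∑ w ∈ Finset.range (N + 1), Polynomial.C (homogeneousComponent w P) * Polynomial.X ^ w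
        with hQdef
      have hQdeg : Q.natDegree ≤ N := by
        refine Polynomial.natDegree_sum_le_of_forall_le _ _ fun w hw => ?_
        refine (Polynomial.natDegree_C_mul_le _ _).trans ((Polynomial.natDegree_pow_le).trans ?_)
        rw [Polynomial.natDegree_X, mul_one]
        exact Nat.le_of_lt_succ (Finset.mem_range.1 hw)
      have hQcoeff : Q.coeff u = homogeneousComponent u P := by
        rw [hQdef, Polynomial.finsetSum_coeff]
        simp_rw [Polynomial.coeff_C_mul_X_pow]
        rw [Finset.sum_ite_eq, if_pos (Finset.mem_range.2 (Nat.lt_succ_of_le hu))]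
      have hQeval : ∀ v : Fin (N + 1), Q.eval (((v : ℕ) : MvPolynomial (Fin n) K)) =
          aeval (fun m : Fin n => (C (((v : ℕ) : K)) * X m : MvPolynomial (Fin n) K)) P := by
        intro v
        rw [aeval_dilate_eq_sum_homogeneousComponent P hPdeg, hQdef, Polynomial.eval_finsetSum]
        refine Finset.sum_congr rfl fun w _ => ?_
        rw [Polynomial.eval_mul, Polynomial.eval_C, Polynomial.eval_pow, Polynomial.eval_X, map_pow,
          map_natCast, mul_comm]
      obtain ⟨β, hβ⟩ := DepthThreeChasm.exists_dual_weights (K := K) N u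
      have hkey := factorial_mul_coeff_eq_sum_eval (A := MvPolynomial (Fin n) K) hu hβ Q hQdeg
      rw [algebraMap_eq, hQcoeff] at hkey
      have hfact : ((u.factorial : ℕ) : K) ≠ 0 := by exact_mod_cast (Nat.factorial_pos u).ne'
      have hcomp : homogeneousComponent u P = C (((u.factorial : ℕ) : K)⁻¹) *
          ∑ v : Fin (N + 1), C (β v) * Q.eval (((v : ℕ) : MvPolynomial (Fin n) K)) := by
        simp_rw [← algebraMap_eq (R := K) (σ := Fin n)]
        rw [algebraMap_eq, ← hkey, ← mul_assoc, ← C_mul, inv_mul_cancel₀ hfact, C_1, one_mul]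
      rw [hcomp]
      refine C_mul_mem_swswClass _ ?_
      have hs := sum_univ_mem_swswClass (K := K) (n := n) (t := 1) (e := e) (δ := δ)
        (fun v : Fin (N + 1) => C (β v) * Q.eval (((v : ℕ) : MvPolynomial (Fin n) K)))
        fun v => C_mul_mem_swswClass _ (by
          rw [hQeval v, hPdef]
          exact aeval_dilate_mem_swswClass _
            (C_mul_wedgePow_mem_swswClass le_rfl (hex i) (c i) (a i) (hp i)))
      rwa [Fintype.card_fin, mul_one] at hs
  rwa [Fintype.card_fin] at h

/-- **Jets of a `Σ∧Σ∧` circuit**: `∑_{u<M} f_u ∈ Σ∧Σ∧(M·(t·(e·δ+1)), e, δ)` for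
`f ∈ Σ∧Σ∧(t, e, δ)`. [cite: DuttaDwivediSaxena2022, Lemma 2.14 and Remarks (full version p0021 L569 – p0022 L584)] -/
theorem sum_homogeneousComponent_mem_swswClass [CharZero K] {t e δ : ℕ}
    {f : MvPolynomial (Fin n) K} (hf : f ∈ swswClass K n t e δ) (M : ℕ) :
    ∑ u ∈ Finset.range M, homogeneousComponent u f ∈ swswClass K n (M * (t * (e * δ + 1))) e δ := by
  have h := sum_mem_swswClass (K := K) (n := n) (t := t * (e * δ + 1)) (e := e) (δ := δ)
    (Finset.range M) (fun u => homogeneousComponent u f) fun u _ =>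
      homogeneousComponent_mem_swswClass hf u
  rwa [Finset.card_range] at h

end Graded

/-! ## §6 Eq. (3.3) for `Σ∧` forms (Claim 5.2): graded pieces of `P/g`, `1/g` and `dlog g = Eg/g` -/

section GradedInverse

/-- The constant coefficient of a univariate placed at `x_m` is its own constant coefficient.
[folklore] -/
private theorem coeff_zero_aeval_X (m : Fin n) (q : Polynomial K) :
    coeff 0 (Polynomial.aeval (X m : MvPolynomial (Fin n) K) q) = q.coeff 0 := by
  rw [← constantCoeff_eq, Polynomial.aeval_def, Polynomial.hom_eval₂, constantCoeff_X,
    Polynomial.coeff_zero_eq_eval_zero, Polynomial.eval]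
  congr 1
  ext a
  simp

/-- The constant coefficient of a `Σ∧` form: `g(0) = a + ∑_m p_m(0)`.
[cite: DuttaDwivediSaxena2022, Claim 5.2 proof, "A − z·B =: h ∈ Σ∧, 0 ≠ A" (full version p0044 L1166–1171)] -/
theorem coeff_zero_wedgeForm (a : K) (p : Fin n → Polynomial K) :
    coeff 0 (wedgeForm a p) = a + ∑ m, (p m).coeff 0 := by
  rw [wedgeForm_eq, coeff_add, coeff_C, if_pos rfl, coeff_sum]
  simp_rw [coeff_zero_aeval_X]

/-- `g(0) − g` is the `Σ∧` form with the negated univariates (the "`z·B`" of `h = A − z·B`).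
[cite: DuttaDwivediSaxena2022, Claim 5.2 proof (full version p0044 L1166–1171)] -/
theorem C_coeff_zero_sub_wedgeForm (a : K) (p : Fin n → Polynomial K) :
    C (coeff 0 (wedgeForm a p)) - wedgeForm a p = wedgeForm (∑ m, (p m).coeff 0) (fun m => -p m) := by
  rw [coeff_zero_wedgeForm, wedgeForm_eq, wedgeForm_eq, map_add]
  simp only [map_neg, Finset.sum_neg_distrib]
  ring

/-- **The truncated inverse of a `Σ∧` form is a `Σ∧Σ∧` circuit**: B4a's
`invJet c g = ∑_{i ≤ c} g(0)^{−(i+1)} (g(0) − g)^i ∈ Σ∧Σ∧(c+1, c, δ)` ("`1/(A − zB) = (1/A)·∑_j (zB/A)^j`",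
eq. (3.3) written for `Σ∧`, p0044 L1167–1171).
[cite: DuttaDwivediSaxena2022, Claim 5.2 proof, eq. after L1171 (full version p0044 L1166–1171)] -/
theorem invJet_wedgeForm_mem_swswClass {δ : ℕ} (c : ℕ) (a : K) {p : Fin n → Polynomial K}
    (hp : ∀ m, (p m).natDegree ≤ δ) :
    invJet c (wedgeForm a p) ∈ swswClass K n (c + 1) c δ := by
  rw [invJet, C_coeff_zero_sub_wedgeForm,
    ← Fin.sum_univ_eq_sum_range (fun i => C ((coeff 0 (wedgeForm a p))⁻¹ ^ (i + 1)) *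
      (wedgeForm (∑ m, (p m).coeff 0) fun m => -p m) ^ i) (c + 1)]
  exact mem_swswClass_of_fintype (ι := Fin (c + 1)) (by simp)
    (fun i => (coeff 0 (wedgeForm a p))⁻¹ ^ ((i : ℕ) + 1)) (fun _ => ∑ m, (p m).coeff 0)
    (fun _ m => -p m) (fun i => (i : ℕ)) (fun i => Nat.le_of_lt_succ i.2)
    (fun _ m => by rw [Polynomial.natDegree_neg]; exact hp m) rfl

/-- **Graded pieces of `P/g` for a `Σ∧Σ∧` numerator and a `Σ∧` form `g` with `g(0) ≠ 0` are
`Σ∧Σ∧` circuits** (eq. (3.3) for `Σ∧` + "`Σ∧Σ∧` is closed under multiplication (Lemma 2.12)",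
p0044 L1172): `gcomp P g c = (P · invJet c g)_c ∈ Σ∧Σ∧(t(c+1)(e+c+1)·((e+c)δ+1), e+c, δ)` by B4a's
division-free formula, `mul_mem_swswClass` and `homogeneousComponent_mem_swswClass`.
Characteristic zero. [cite: DuttaDwivediSaxena2022, Claim 5.2 proof (full version p0044 L1166–1175)] -/
theorem gcomp_wedgeForm_mem_swswClass [CharZero K] {t e δ : ℕ} {P : MvPolynomial (Fin n) K}
    (hP : P ∈ swswClass K n t e δ) (a : K) {p : Fin n → Polynomial K}
    (hp : ∀ m, (p m).natDegree ≤ δ) (h0 : coeff 0 (wedgeForm a p) ≠ 0) (c : ℕ) :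
    gcomp P (wedgeForm a p) c ∈
      swswClass K n (t * (c + 1) * (e + c + 1) * ((e + c) * δ + 1)) (e + c) δ := by
  rw [gcomp_eq_homogeneousComponent_mul_invJet h0]
  exact homogeneousComponent_mem_swswClass
    (mul_mem_swswClass hP (invJet_wedgeForm_mem_swswClass c a hp)) c

/-- **Graded pieces of `1/g`** for a `Σ∧` form `g` with `g(0) ≠ 0`:
`gcomp 1 g c ∈ Σ∧Σ∧((c+1)(cδ+1), c, δ)`.
[cite: DuttaDwivediSaxena2022, Claim 5.2 proof, eq. after L1171 (full version p0044 L1166–1171)] -/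
theorem gcomp_one_wedgeForm_mem_swswClass [CharZero K] {δ : ℕ} (a : K) {p : Fin n → Polynomial K}
    (hp : ∀ m, (p m).natDegree ≤ δ) (h0 : coeff 0 (wedgeForm a p) ≠ 0) (c : ℕ) :
    gcomp 1 (wedgeForm a p) c ∈ swswClass K n ((c + 1) * (c * δ + 1)) c δ := by
  rw [gcomp_eq_homogeneousComponent_mul_invJet h0, one_mul]
  exact homogeneousComponent_mem_swswClass (invJet_wedgeForm_mem_swswClass c a hp) c

/-- Degree bookkeeping for `X · q'`. [folklore] -/
private theorem natDegree_X_mul_derivative_le {δ : ℕ} {q : Polynomial K} (hq : q.natDegree ≤ δ) :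
    (Polynomial.X * Polynomial.derivative q).natDegree ≤ δ := by
  rcases Nat.eq_zero_or_pos q.natDegree with h0 | hpos
  · rw [Polynomial.derivative_of_natDegree_zero h0, mul_zero, Polynomial.natDegree_zero]
    exact Nat.zero_le _
  · refine Polynomial.natDegree_mul_le.trans ?_
    calc Polynomial.X.natDegree + (Polynomial.derivative q).natDegree
        ≤ 1 + (q.natDegree - 1) :=
          Nat.add_le_add Polynomial.natDegree_X_le (Polynomial.natDegree_derivative_le q)
      _ = q.natDegree := by omega
      _ ≤ δ := hq

/-- **The Euler derivative of a `Σ∧` form is a `Σ∧` form**: `E(a + ∑_m p_m(x_m)) = ∑_m x_m p_m'(x_m)`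
(B4a's `euler`; the `∂_z(z·B)` of Claim 5.2 in the Euler frame).
[cite: DuttaDwivediSaxena2022, Claim 5.2 proof, eq. after L1171 (full version p0044 L1166–1171)] -/
theorem euler_wedgeForm (a : K) (p : Fin n → Polynomial K) :
    euler (Fin n) K (wedgeForm a p) =
      wedgeForm 0 (fun m => Polynomial.X * Polynomial.derivative (p m)) := by
  rw [wedgeForm_eq, wedgeForm_eq, map_add, euler_C, zero_add, C_0, zero_add, map_sum]
  refine Finset.sum_congr rfl fun m _ => ?_
  rw [(euler (Fin n) K).map_aeval, euler_X, smul_eq_mul, map_mul, Polynomial.aeval_X, mul_comm]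

/-- `E g ∈ Σ∧Σ∧(1, 1, δ)` for a `Σ∧` form `g` with univariates of degree `≤ δ`.
[cite: DuttaDwivediSaxena2022, Claim 5.2 proof (full version p0044 L1166–1175)] -/
theorem euler_wedgeForm_mem_swswClass {δ : ℕ} (a : K) {p : Fin n → Polynomial K}
    (hp : ∀ m, (p m).natDegree ≤ δ) : euler (Fin n) K (wedgeForm a p) ∈ swswClass K n 1 1 δ := by
  rw [euler_wedgeForm]
  have h := wedgePow_mem_swswClass (K := K) (t := 1) (e := 1) (k := 1) le_rfl le_rfl (0 : K)
    (p := fun m => Polynomial.X * Polynomial.derivative (p m))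
    fun m => natDegree_X_mul_derivative_le (hp m)
  rwa [pow_one] at h

/-- **`dlog` of a `Σ∧` form is a `Σ∧Σ∧` circuit, graded form (DDS21 Claim 5.2)**: for a `Σ∧` form
`g` with `g(0) ≠ 0` and univariates of degree `≤ δ`, every graded piece of `Eg/g` lies in
`Σ∧Σ∧((c+1)(c+2)((c+1)δ+1), c+1, δ)` ("`dlog(h) = −∂_z(zB)/A · ∑_j (zB/A)^j` … it readily follows
that `dlog(ΠΣ∧) ∈ Σ∧Σ∧`", with the Euler derivation for `∂_z` as in B4a/B4b). Characteristic zero.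
[cite: DuttaDwivediSaxena2022, Claim 5.2 with proof (full version p0044 L1164–1175)] -/
theorem gcomp_euler_wedgeForm_mem_swswClass [CharZero K] {δ : ℕ} (a : K)
    {p : Fin n → Polynomial K} (hp : ∀ m, (p m).natDegree ≤ δ)
    (h0 : coeff 0 (wedgeForm a p) ≠ 0) (c : ℕ) :
    gcomp (euler (Fin n) K (wedgeForm a p)) (wedgeForm a p) c ∈
      swswClass K n (1 * (c + 1) * (1 + c + 1) * ((1 + c) * δ + 1)) (1 + c) δ :=
  gcomp_wedgeForm_mem_swswClass (euler_wedgeForm_mem_swswClass a hp) a hp h0 c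

end GradedInverse

end DDS2021

end Literature.Computability.AlgebraicComplexity
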